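import Mathlib
import HarnessLib
import Summits.Ventures.LatticeQCDFlow.Scoring.AllPairsAcceptanceVariance

/-!
# LatticeQCDFlow / Scoring — the ceiling-free envelope of the all-pairs acceptance variance is
# ATTAINED on EVERY space: hit-or-miss flows `p = q·𝟙_A / q(A)`

HONEST FRAMING: exact (Metropolis-corrected) sampling algorithms for lattice gauge theory;
figures of merit are autocorrelation/cost numbers at stated couplings and volumes; no
continuum-physics claim.

Venture `LatticeQCDFlow` (cell pub-lqcd), sub-topic `Scoring`; FANOUT row 3 (`s0-u1-a`, S0-B
implementation A, GEN-10).  NEW WORK of the cell (elementary), the general-space form of the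
two-point witness of row 3's finite `Scoring/PairAcceptanceVarianceSharp`
(`exists_variance_pairMin_eq_sharp`): in the setting of `Scoring/AllPairsAcceptanceVariance`
(imported; reference measure `μ`, model density `q > 0`, `n ≥ 2` independent model draws with law
`q dμ` on an abstract probability space) take ANY measurable region `A` of model mass
`α = ∫_A q dμ > 0` and the HIT-OR-MISS target `p = q·𝟙_A/α` (the model conditioned on `A`: every
proposal is either an exact target draw or has target weight `0`; `w = p/q = 𝟙_A/α`).  Then
`acc = α`, Hoeffding's `c₂ = 1` and `c₁ = α` exactly, so the envelope
`Var[Û] ≤ (2(1 − a²) + 4(n − 2)·a(1 − a))/(n(n − 1))` of `variance_allPairs_le_sharp` holds with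
EQUALITY at `a = α` — on every space, for every model, at every `n ≥ 2` and every attainable
acceptance `α`.  NO definition is introduced.

* `hitOrMiss_weight_eq` (`w = 𝟙_A/α`), `hitOrMiss_pairMin_eq`
  (`min(w(a), w(b)) = w(a)·𝟙_A(b)`), `hitOrMiss_target_normalised` (`p ≥ 0`, `∫ p = 1`),
  `withDensity_real_eq` (`(q dμ)(A) = α`);
* `hitOrMiss_meanAccept` (`acc = α`), `hitOrMiss_sqMoment` (`c₂ = 1`), `hitOrMiss_condMean`
  (`h = 𝟙_A`), `hitOrMiss_condMeanSq` (`c₁ = α`);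
* **`variance_allPairs_hitOrMiss`** — `Var[Û] = (2(1 − α²) + 4(n − 2)·α(1 − α))/(n(n − 1))`.

NOT CLAIMED: uniqueness of the maximiser; any number of ours.
-/

namespace Summit.Ventures.LatticeQCDFlow.Scoring.AllPairsVariance

open MeasureTheory ProbabilityTheory Finset Set

variable {Ω : Type*} [MeasurableSpace Ω] {P : Measure Ω} [IsProbabilityMeasure P]
variable {X : Type*} [MeasurableSpace X] {μ : Measure X} {n : ℕ} {q : X → ℝ} {A : Set X} {α : ℝ}

/-! ## §1 The hit-or-miss pair: weight, kernel, normalisation -/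

omit [MeasurableSpace X] in
/-- **`w = 𝟙_A/α`**: the importance weight of the hit-or-miss target `p = q·𝟙_A/α`. [ours] -/
theorem hitOrMiss_weight_eq (hq0 : ∀ y, 0 < q y) (y : X) :
    A.indicator q y / α / q y = A.indicator (fun _ => α⁻¹) y := by
  by_cases hy : y ∈ A
  · rw [indicator_of_mem hy, indicator_of_mem hy, div_div, mul_comm, ← div_div,
      div_self (hq0 y).ne', one_div]
  · rw [indicator_of_notMem hy, indicator_of_notMem hy, zero_div, zero_div]

omit [MeasurableSpace X] in
/-- **`min(w(a), w(b)) = w(a)·𝟙_A(b)`** for the two-valued weight `w = 𝟙_A/α`, `α > 0`. [ours] -/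
theorem hitOrMiss_pairMin_eq (hα : 0 < α) (a b : X) :
    min (A.indicator (fun _ => (α⁻¹ : ℝ)) a) (A.indicator (fun _ => α⁻¹) b)
      = A.indicator (fun _ => (α⁻¹ : ℝ)) a * A.indicator (fun _ => (1 : ℝ)) b := by
  by_cases ha : a ∈ A
  · by_cases hb : b ∈ A
    · simp [indicator_of_mem ha, indicator_of_mem hb]
    · simp [indicator_of_mem ha, indicator_of_notMem hb, inv_nonneg.2 hα.le]
  · by_cases hb : b ∈ A
    · simp [indicator_of_notMem ha, indicator_of_mem hb, inv_nonneg.2 hα.le]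
    · simp [indicator_of_notMem ha, indicator_of_notMem hb]

/-- **The hit-or-miss target is a normalised density**: `p = q·𝟙_A/α ≥ 0` is measurable,
integrable, and `∫ p dμ = 1` when `∫_A q dμ = α > 0`. [ours] -/
theorem hitOrMiss_target_normalised (hq0 : ∀ y, 0 < q y) (hqm : Measurable q)
    (hqi : Integrable q μ) (hAm : MeasurableSet A) (hα : 0 < α) (hAq : ∫ y in A, q y ∂μ = α) :
    (∀ y, 0 ≤ A.indicator q y / α) ∧ Measurable (fun y => A.indicator q y / α) ∧
    Integrable (fun y => A.indicator q y / α) μ ∧ ∫ y, A.indicator q y / α ∂μ = 1 := by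
  refine ⟨fun y => div_nonneg (indicator_nonneg (fun z _ => (hq0 z).le) y) hα.le,
    (hqm.indicator hAm).div_const α, (hqi.indicator hAm).div_const α, ?_⟩
  rw [integral_div, integral_indicator hAm, hAq, div_self hα.ne']

/-- **`(q dμ)(A) = α` in real form.** [folklore] -/
theorem withDensity_real_eq (hq0 : ∀ y, 0 < q y) (hqi : Integrable q μ) (hAm : MeasurableSet A)
    (hα : 0 < α) (hAq : ∫ y in A, q y ∂μ = α) :
    (μ.withDensity fun y => ENNReal.ofReal (q y)).real A = α := by
  rw [measureReal_def, withDensity_apply _ hAm,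
    ← ofReal_integral_eq_lintegral_ofReal hqi.integrableOn
      (Filter.Eventually.of_forall fun y => (hq0 y).le), hAq, ENNReal.toReal_ofReal hα.le]

/-! ## §2 The three moments: `acc = α`, `c₂ = 1`, `c₁ = α` -/

/-- `∫ 𝟙_A d(q dμ) = α` and `∫ w d(q dμ) = 1`, `∫ w² d(q dμ) = 1/α` for `w = 𝟙_A/α`. [ours] -/
theorem hitOrMiss_weight_integrals (hq0 : ∀ y, 0 < q y) (hqi : Integrable q μ)
    (hAm : MeasurableSet A) (hα : 0 < α) (hAq : ∫ y in A, q y ∂μ = α) :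
    ∫ y, A.indicator (fun _ => (1 : ℝ)) y ∂(μ.withDensity fun y => ENNReal.ofReal (q y)) = α ∧
    ∫ y, A.indicator (fun _ => (α⁻¹ : ℝ)) y ∂(μ.withDensity fun y => ENNReal.ofReal (q y)) = 1 ∧
    ∫ y, A.indicator (fun _ => (α⁻¹ : ℝ)) y ^ 2 ∂(μ.withDensity fun y => ENNReal.ofReal (q y))
      = α⁻¹ := by
  have hr := withDensity_real_eq hq0 hqi hAm hα hAq
  have e2 : ∀ y, A.indicator (fun _ => (α⁻¹ : ℝ)) y ^ 2 = A.indicator (fun _ => (α⁻¹ ^ 2 : ℝ)) y :=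
    fun y => by by_cases hy : y ∈ A <;> simp [hy]
  refine ⟨?_, ?_, ?_⟩
  · rw [integral_indicator_const _ hAm, hr, smul_eq_mul, mul_one]
  · rw [integral_indicator_const _ hAm, hr, smul_eq_mul, mul_inv_cancel₀ hα.ne']
  · simp_rw [e2]
    rw [integral_indicator_const _ hAm, hr, smul_eq_mul]
    field_simp

/-- **`acc = α`**: `∫∫ min(p(a)q(b), p(b)q(a)) dμ dμ = α` for the hit-or-miss target. [ours] -/
theorem hitOrMiss_meanAccept [SFinite μ] (hq0 : ∀ y, 0 < q y) (hqm : Measurable q)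
    (hqi : Integrable q μ) (hAm : MeasurableSet A) (hα : 0 < α) (hAq : ∫ y in A, q y ∂μ = α) :
    ∫ a, ∫ b, min (A.indicator q a / α * q b) (A.indicator q b / α * q a) ∂μ ∂μ = α := by
  obtain ⟨hp0, hpm, hpi, -⟩ := hitOrMiss_target_normalised (μ := μ) hq0 hqm hqi hAm hα hAq
  obtain ⟨h1, hw, -⟩ := hitOrMiss_weight_integrals (μ := μ) hq0 hqi hAm hα hAq
  rw [← integral_pairMin_withDensity_eq_meanAccept hp0 hpm hpi hq0 hqm hqi]
  simp_rw [hitOrMiss_weight_eq hq0, hitOrMiss_pairMin_eq hα]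
  rw [integral_prod_mul (fun a => A.indicator (fun _ => (α⁻¹ : ℝ)) a)
      (fun b => A.indicator (fun _ => (1 : ℝ)) b), hw, h1, one_mul]

/-- **`c₂ = 1`**: `∫ min(w, w′)² d((q dμ)⊗(q dμ)) = 1` for the hit-or-miss weight. [ours] -/
theorem hitOrMiss_sqMoment [SFinite μ] (hq0 : ∀ y, 0 < q y) (hqi : Integrable q μ)
    (hAm : MeasurableSet A) (hα : 0 < α) (hAq : ∫ y in A, q y ∂μ = α) :
    ∫ z, min (A.indicator q z.1 / α / q z.1) (A.indicator q z.2 / α / q z.2) ^ 2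
        ∂(μ.withDensity fun y => ENNReal.ofReal (q y)).prod
          (μ.withDensity fun y => ENNReal.ofReal (q y)) = 1 := by
  obtain ⟨h1, -, hw2⟩ := hitOrMiss_weight_integrals (μ := μ) hq0 hqi hAm hα hAq
  have e1 : ∀ b, A.indicator (fun _ => (1 : ℝ)) b ^ 2 = A.indicator (fun _ => (1 : ℝ)) b :=
    fun b => by by_cases hb : b ∈ A <;> simp [hb]
  simp_rw [hitOrMiss_weight_eq hq0, hitOrMiss_pairMin_eq hα, mul_pow, e1]
  rw [integral_prod_mul (fun a => A.indicator (fun _ => (α⁻¹ : ℝ)) a ^ 2)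
      (fun b => A.indicator (fun _ => (1 : ℝ)) b), hw2, h1, inv_mul_cancel₀ hα.ne']

/-- **`h = 𝟙_A`**: Hoeffding's projection of the hit-or-miss kernel is the indicator of the target
region. [ours] -/
theorem hitOrMiss_condMean (hq0 : ∀ y, 0 < q y) (hqi : Integrable q μ) (hAm : MeasurableSet A)
    (hα : 0 < α) (hAq : ∫ y in A, q y ∂μ = α) (a : X) :
    ∫ b, min (A.indicator q a / α / q a) (A.indicator q b / α / q b)
        ∂(μ.withDensity fun y => ENNReal.ofReal (q y))
      = A.indicator (fun _ => (1 : ℝ)) a := by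
  obtain ⟨h1, -, -⟩ := hitOrMiss_weight_integrals (μ := μ) hq0 hqi hAm hα hAq
  simp_rw [hitOrMiss_weight_eq hq0, hitOrMiss_pairMin_eq hα]
  rw [integral_const_mul, h1]
  by_cases ha : a ∈ A
  · simp [indicator_of_mem ha, inv_mul_cancel₀ hα.ne']
  · simp [indicator_of_notMem ha]

/-- **`c₁ = α`**: `∫ h² d(q dμ) = α` for the hit-or-miss kernel. [ours] -/
theorem hitOrMiss_condMeanSq (hq0 : ∀ y, 0 < q y) (hqi : Integrable q μ)
    (hAm : MeasurableSet A) (hα : 0 < α) (hAq : ∫ y in A, q y ∂μ = α) :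
    ∫ a, (∫ b, min (A.indicator q a / α / q a) (A.indicator q b / α / q b)
        ∂(μ.withDensity fun y => ENNReal.ofReal (q y))) ^ 2
        ∂(μ.withDensity fun y => ENNReal.ofReal (q y)) = α := by
  obtain ⟨h1, -, -⟩ := hitOrMiss_weight_integrals (μ := μ) hq0 hqi hAm hα hAq
  have e1 : ∀ b, A.indicator (fun _ => (1 : ℝ)) b ^ 2 = A.indicator (fun _ => (1 : ℝ)) b :=
    fun b => by by_cases hb : b ∈ A <;> simp [hb]
  simp_rw [hitOrMiss_condMean hq0 hqi hAm hα hAq, e1]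
  exact h1

/-! ## §3 Equality in the envelope -/

/-- **THE ENVELOPE IS ATTAINED ON EVERY SPACE.**  For every model density `q > 0`, every
measurable region `A` of model mass `α = ∫_A q dμ > 0`, the hit-or-miss target `p = q·𝟙_A/α` and
`n ≥ 2` independent model draws:
`Var[Û] = (2(1 − α²) + 4(n − 2)·α(1 − α))/(n(n − 1))` — equality in `variance_allPairs_le_sharp`
at `a = acc = α` (`hitOrMiss_meanAccept`). [ours] -/
theorem variance_allPairs_hitOrMiss [SFinite μ] {x : Fin n → Ω → X}
    (hxm : ∀ i, Measurable (x i)) (hind : iIndepFun x P) (hq0 : ∀ y, 0 < q y)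
    (hqm : Measurable q) (hqi : Integrable q μ) (hAm : MeasurableSet A) (hα : 0 < α)
    (hAq : ∫ y in A, q y ∂μ = α)
    (hlaw : ∀ i, Measure.map (x i) P = μ.withDensity fun y => ENNReal.ofReal (q y))
    (hn : 2 ≤ n) :
    Var[fun ω => (∑ z ∈ (univ : Finset (Fin n)).offDiag,
        min (A.indicator q (x z.1 ω) / α / q (x z.1 ω)) (A.indicator q (x z.2 ω) / α / q (x z.2 ω)))
        / (n * (n - 1) : ℝ); P]
      = (2 * (1 - α ^ 2) + 4 * (n - 2) * (α * (1 - α))) / (n * (n - 1)) := by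
  obtain ⟨hp0, hpm, hpi, -⟩ := hitOrMiss_target_normalised (μ := μ) hq0 hqm hqi hAm hα hAq
  rw [variance_allPairs_eq hxm hind hp0 hpm hpi hq0 hqm hqi hlaw hn,
    hitOrMiss_sqMoment hq0 hqi hAm hα hAq, hitOrMiss_condMeanSq hq0 hqi hAm hα hAq,
    hitOrMiss_meanAccept hq0 hqm hqi hAm hα hAq]
  ring

end Summit.Ventures.LatticeQCDFlow.Scoring.AllPairsVariance
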